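import Literature.AlgebraicGeometry.HodgeTheory.HodgeRiemannPolarizabilityProofs
import Literature.AlgebraicGeometry.HodgeTheory.HodgeGenericFiniteMonodromyOfInputs
import Literature.AlgebraicGeometry.Motives.VarietiesProperProofs
import HarnessLib

/-!
# Hodge–Riemann for the relative hyperplane class of a quasi-projective family (the input `hHR`)

Family `hodge`, layer `Literature/AlgebraicGeometry/HodgeTheory`; proof file (theorems only, no
definition, no named fact) of the unit `bku_finite_monodromyOrbit_of_isHodgeGenericIn`
(`HodgeGenericQbarDescent.lean`; Baldi–Klingler–Ullmo, Invent. Math. 235 (2024), §3.2).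

The assembly `bku_finite_monodromyOrbit_of_isHodgeGenericIn_of_inputs`
(`HodgeGenericFiniteMonodromyOfInputs`) isolates two classical inputs. This file DISCHARGES the
first one, `hHR` — Hodge–Riemann for the polarization form of the Lefschetz decomposition of the
restriction of a GLOBAL class `K ∈ H²(𝒳(ℂ); ℂ)` — from the tree's proof of the polarizability of the
Hodge structure of a smooth projective variety (`HodgeRiemannPolarizabilityProofs`:
`KaehlerRationalDatum`, `cform_conj_pos`, `algebraMap_form`; C. Voisin, *Hodge Theory and Complex
Algebraic Geometry I*, Thm. 6.25, Thm. 6.32, §7.1.2), the only new point being GLOBALITY: for a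
family `f : 𝒳 ⟶ S` with `𝒳` quasi-projective, `𝒳 ↪ P ↪ ℙᴺ`, every fibre `X_s ↪ 𝒳 ↪ ℙᴺ` is a closed
immersion, and the Kähler–rational datum of `X_s` can be chosen with rational Kähler class the
restriction to `X_s` of the pull-back to `𝒳(ℂ)` of a class of `H²(ℙᴺ(ℂ); ℂ)` (the argument of
`exists_fubiniStudy_rational`, file `FubiniStudyClassRational`, run for a PRESCRIBED embedding:
`exists_kaehlerRationalDatum_eq_map`). Consequently the named fact follows from the single remaining
input `hType` (type stability of monodromy translates at a Hodge-generic point; Deligne 1972,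
Prop. 7.5; André 1992, Thm. 1): `bku_finite_monodromyOrbit_of_isHodgeGenericIn_of_hType`.

## References

* [BaldiKlinglerUllmo2024] G. Baldi, B. Klingler, E. Ullmo, On the distribution of the Hodge locus,
  Invent. Math. 235 (2024), §3.2.
* [VoisinHodgeI2002] C. Voisin, Hodge Theory and Complex Algebraic Geometry I, CUP 2002, §3.3.2
  Lemma 3.16, Thm. 6.25, Thm. 6.32, §7.1.2, §7.1.3 Thm. 7.10.
* [Deligne1972WeilK3] P. Deligne, La conjecture de Weil pour les surfaces K3, Invent. Math. 15
  (1972), Prop. 7.5.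
* [DeligneHodgeII1971] P. Deligne, Théorie de Hodge II, Publ. Math. IHÉS 40 (1971), §4.2.
* [SerreGAGA1956] J.-P. Serre, Géométrie algébrique et géométrie analytique, Ann. Inst. Fourier 6
  (1956), §2 n°5.
* [Hartshorne1977] R. Hartshorne, Algebraic Geometry, GTM 52, II §4 (Cor. 4.8, Ex. 4.9).
-/

noncomputable section

open CategoryTheory AlgebraicGeometry Limits
open scoped Manifold ContDiff Topology
open Literature.AlgebraicTopology.SingularHomology Literature.Geometry.Kaehler
open Literature.NumberTheory.Transcendental
open Literature.AlgebraicGeometry.Motives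
open Literature.AlgebraicGeometry.Motives.AnalytificationKaehler

namespace Literature.AlgebraicGeometry.HodgeTheory

section HodgeTheory

/-! ### Fibres of a proper family with quasi-projective total space embed in `ℙᴺ` -/

section Scheme

variable {𝒳 S : SchemeOver ℂ}

/-- **The fibres of a proper family whose total space maps to `ℙᴺ` by a preimmersion are closed
subschemes of `ℙᴺ`**: for `f : 𝒳 ⟶ S` proper over a separated `S` and `ε : 𝒳 ⟶ ℙᴺ` a preimmersion
(e.g. an open immersion into a projective scheme followed by its projective embedding),
`X_s ↪ 𝒳 → ℙᴺ` is a closed immersion (`X_s ↪ 𝒳` is the base change of the closed point `s`, and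
`X_s → ℙᴺ` is proper, hence has closed image). The two inputs — a complex point of the separated `S`
is a closed immersion `Spec ℂ → S`, and the fibre `X_s → Spec ℂ` of the proper `f` is proper (base
change, Hartshorne II Cor. 4.8 (c)) — are `Motives.CurveNet.isClosedImmersion_left_of_isSeparated`
and `isProper_fiberOver_hom` (file `GlobalInvariantCyclesProofs`), used directly.
[cite: Hartshorne1977, II Cor. 4.8 and Ex. 4.9] -/
theorem isClosedImmersion_fiberι_comp_left_of_isPreimmersion (f : 𝒳 ⟶ S) [IsProper f.left]
    [IsSeparated S.hom] {N : ℕ} (ε : 𝒳 ⟶ projectiveSpace N ℂ) [IsPreimmersion ε.left]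
    (s : ComplexPoints S) : IsClosedImmersion (fiberι f s ≫ ε).left := by
  haveI : IsClosedImmersion s.left := Motives.CurveNet.isClosedImmersion_left_of_isSeparated s
  haveI : IsClosedImmersion (fiberι f s).left := by
    rw [fiberι_left]
    exact MorphismProperty.pullback_fst (P := @IsClosedImmersion) _ _ inferInstance
  haveI : IsPreimmersion (fiberι f s ≫ ε).left := by
    rw [Over.comp_left]
    infer_instance
  haveI : IsProper (fiberOver f s).hom := isProper_fiberOver_hom f s
  haveI : IsProper (projectiveSpace N ℂ).hom := isProper_projectiveSpace N ℂ
  haveI : IsProper ((fiberι f s ≫ ε).left ≫ (projectiveSpace N ℂ).hom) := by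
    rw [Over.w]
    infer_instance
  haveI : IsProper (fiberι f s ≫ ε).left := IsProper.of_comp (fiberι f s ≫ ε).left (projectiveSpace N ℂ).hom
  exact IsClosedImmersion.of_isPreimmersion _ (fiberι f s ≫ ε).left.isClosedMap.isClosed_range

/-- A quasi-projective `ℂ`-scheme is separated over `ℂ` (open immersion into a projective, hence
proper, `ℂ`-scheme). [cite: Hartshorne1977, II Thm. 4.9] -/
theorem IsQuasiProjectiveOver.isSeparated (hS : IsQuasiProjectiveOver S) : IsSeparated S.hom := by
  obtain ⟨P, j, hP, hj⟩ := hS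
  haveI := hj
  haveI : IsProper P.hom := hP.isProper
  rw [← Over.w j]
  infer_instance

/-- **A quasi-projective `ℂ`-scheme maps to some `ℙᴺ` by a preimmersion** `𝒳 ↪ P ↪ ℙᴺ` (open
immersion into a projective `P`, composed with a closed immersion `P ↪ ℙᴺ`). [cite: Hartshorne1977, II §4 (definition of quasi-projective)] -/
theorem IsQuasiProjectiveOver.exists_isPreimmersion (h𝒳 : IsQuasiProjectiveOver 𝒳) :
    ∃ (N : ℕ) (ε : 𝒳 ⟶ projectiveSpace N ℂ), IsPreimmersion ε.left := by
  obtain ⟨P, j, hP, hj⟩ := h𝒳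
  obtain ⟨N, ιP, hιP⟩ := hP
  haveI := hj
  haveI := hιP
  refine ⟨N, j ≫ ιP, ?_⟩
  rw [Over.comp_left]
  infer_instance

end Scheme

/-! ### A Kähler–rational datum with PRESCRIBED projective embedding -/

section Datum

variable {n : ℕ} {X : SchemeOver ℂ}

/-- **A Kähler–rational datum whose rational Kähler class is a pull-back from `ℙᴺ` along a GIVEN
closed immersion `ι : X ⟶ ℙᴺ`.** The argument of `exists_fubiniStudy_rational` (file
`FubiniStudyClassRational`, there run for a chosen embedding) for the prescribed `ι`: with `B` a Hodge
model of `X`, `e` a natural multiplicative real de Rham family and `H` the class with `B^*H = e[θ] ⊗ 1`,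
`θ = (ι^an)^*θ_ℙ` the restricted Fubini–Study form, the rigidity of natural de Rham comparisons and
`H²(ℙᴺ(ℂ); ℂ) = ℂ · (rational class)` give `H = μ · ι(ℂ)^*c_ℚ` with `μ` real (both classes are
real), so `|μ|⁻¹ H = ι(ℂ)^*(±c_ℚ)` is rational AND a pull-back; it is the Kähler class of the Kähler
metric `|μ|⁻¹ g_θ` (`isKaehlerClassVia_of_pullback_eq_fubiniStudyPullbackForm`,
`IsKaehlerClassVia.smul_of_pos`). (If `H = 0`, i.e. `n = 0`, take `η = 0 = ι(ℂ)^* 0`.)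
[cite: VoisinHodgeI2002, §7.1.2, §7.1.3 Thm. 7.10 and §3.3.2 Lemma 3.16] [cite: SerreGAGA1956, §2 n°5] -/
theorem exists_kaehlerRationalDatum_eq_map (hX : Motives.IsSmoothProjective n X) {N : ℕ}
    (ι : X ⟶ projectiveSpace N ℂ) [IsClosedImmersion ι.left] :
    ∃ (D : KaehlerRationalDatum n X) (c : complexBetti (projectiveSpace N ℂ) 2),
      D.Hη = complexBetti.map ι 2 c := by
  obtain ⟨B, -⟩ := exists_isReal_hodgeModel_holds n X hX
  have hP : Motives.IsSmoothProjective N (projectiveSpace N ℂ) :=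
    Motives.isSmoothProjective_projectiveSpace_holds ℂ N
  obtain ⟨A, -⟩ := exists_isReal_hodgeModel_holds N (projectiveSpace N ℂ) hP
  obtain ⟨e, he, hem, -⟩ := exists_deRhamIsoFamily_holds B.model
  have hθ := B.fubiniStudyPullbackForm_mem_closedSmoothForms ι
  obtain ⟨H, hH⟩ := B.pullback_surjective 2 (ofRealClass B.carrier 2 (e B.carrier 2
    (deRhamCohomology.mk ⟨fubiniStudyPullbackForm B.model ι B.toComplexPoints, hθ⟩)))
  have hKV : B.IsKaehlerClassVia e H :=
    B.isKaehlerClassVia_of_pullback_eq_fubiniStudyPullbackForm e hX ι hθ hH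
  -- it suffices to show that `H` is a complex multiple of the pull-back of a rational class
  suffices hrat : ∃ (cR : complexBetti (projectiveSpace N ℂ) 2) (μ : ℂ),
      IsRationalClass cR ∧ H = μ • complexBetti.map ι 2 cR by
    obtain ⟨cR, μ, hcR, hHμ⟩ := hrat
    have hρ : IsRationalClass (complexBetti.map ι 2 cR) := IsRationalClass.map _ hcR
    by_cases h0 : H = 0
    · obtain ⟨g, hg, hgH⟩ := hKV
      refine ⟨⟨B, e, he, hem, g, hg, 0, by rw [map_zero, ← h0]; exact hgH⟩, 0, ?_⟩
      change ofRatClass _ 2 0 = _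
      rw [map_zero, map_zero]
    have hconj := hKV.conjClass_eq
    rw [hHμ, conjClass_smul, hρ.conjClass_eq] at hconj
    have hρ0 : complexBetti.map ι 2 cR ≠ 0 := fun h ↦ h0 (by rw [hHμ, h, smul_zero])
    have hμ : starRingEnd ℂ μ = μ := smul_left_injective ℂ hρ0 hconj
    have hμre : (μ.re : ℂ) = μ := Complex.conj_eq_iff_re.1 hμ
    have hμ0 : μ.re ≠ 0 := fun h ↦ h0 (by rw [hHμ, ← hμre, h, Complex.ofReal_zero, zero_smul])
    have hsmul : ((|μ.re|⁻¹ : ℝ) : ℂ) • H = ((|μ.re|⁻¹ * μ.re : ℝ) : ℂ) • complexBetti.map ι 2 cR := by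
      rw [hHμ, smul_smul, Complex.ofReal_mul, hμre]
    obtain ⟨ε, hε⟩ : ∃ ε : ℚ, ((|μ.re|⁻¹ : ℝ) : ℂ) • H = ((ε : ℚ) : ℂ) • complexBetti.map ι 2 cR := by
      rcases lt_or_gt_of_ne hμ0 with hneg | hpos
      · refine ⟨-1, ?_⟩
        rw [hsmul, abs_of_neg hneg, inv_neg, neg_mul, inv_mul_cancel₀ hμ0, Complex.ofReal_neg,
          Complex.ofReal_one, Rat.cast_neg, Rat.cast_one]
      · refine ⟨1, ?_⟩
        rw [hsmul, abs_of_pos hpos, inv_mul_cancel₀ hμ0, Complex.ofReal_one, Rat.cast_one]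
    have hrat' : IsRationalClass (((|μ.re|⁻¹ : ℝ) : ℂ) • H) := by
      rw [hε]
      exact hρ.smul ε
    obtain ⟨g, hg, hgH⟩ := hKV.smul_of_pos (inv_pos.2 (abs_pos.2 hμ0))
    obtain ⟨η, hη⟩ := (isRationalClass_iff_mem_range_ofRatClass _).1 hrat'
    refine ⟨⟨B, e, he, hem, g, hg, η, by rw [hη]; exact hgH⟩, ((ε : ℚ) : ℂ) • cR, ?_⟩
    change ofRatClass _ 2 η = _
    rw [hη, hε, _root_.map_smul]
  -- the analytified embedding and `θ_X = (ι^an)^* θ_ℙ`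
  have hmn : n ≤ N := dim_le_of_isClosedImmersion_projectiveSpace hX ι B A
  set f := HodgeModel.anMap A B ι with hfdef
  have hfan : ContMDiff 𝓘(ℝ, B.model) 𝓘(ℝ, A.model) ∞ f := HodgeModel.contMDiff_anMap A B ι hX hP
  have hfd : MDifferentiable 𝓘(ℝ, B.model) 𝓘(ℝ, A.model) f :=
    (HodgeModel.mdifferentiable_anMap A B ι hX hP).real_of_complex
  have hθX := fubiniStudyPullbackForm_eq_pullback ι (E := B.model) (φ := B.toComplexPoints)
    A.isAnalytification (f := f) (HodgeModel.toComplexPoints_anMap A B ι) hfd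
  have hθP := A.fubiniStudyPullbackForm_mem_closedSmoothForms (𝟙 (projectiveSpace N ℂ))
  -- the de Rham classes of `θ_ℙ ⊗ 1` and `θ_X ⊗ 1`
  set wP : complexDeRhamCohomology A.model A.carrier 2 :=
    complexDeRhamCohomology.ofReal A.model A.carrier 2
      (deRhamCohomology.mk ⟨fubiniStudyPullbackForm A.model (𝟙 (projectiveSpace N ℂ)) A.toComplexPoints, hθP⟩)
    with hwP
  set wX : complexDeRhamCohomology B.model B.carrier 2 :=
    complexDeRhamCohomology.ofReal B.model B.carrier 2
      (deRhamCohomology.mk ⟨fubiniStudyPullbackForm B.model ι B.toComplexPoints, hθ⟩) with hwX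
  have hwPX : complexDeRhamCohomology.map B.model hfan 2 wP = wX := by
    rw [hwP, hwX, complexDeRhamCohomology.ofReal_mk, complexDeRhamCohomology.ofReal_mk,
      complexDeRhamCohomology.map_mk]
    congr 1
    apply Subtype.ext
    change (fubiniStudyPullbackForm A.model (𝟙 (projectiveSpace N ℂ)) A.toComplexPoints).ofReal.pullback
        𝓘(ℝ, B.model) f = (fubiniStudyPullbackForm B.model ι B.toComplexPoints).ofReal
    rw [hθX, mform_ofReal_pullback]
  -- a class `c_ℙ` on `ℙᴺ(ℂ)` comparing to `θ_ℙ ⊗ 1` in the model `A`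
  obtain ⟨cP, hcP⟩ := A.pullback_surjective 2 (A.deRham A.carrier 2 wP)
  haveI : CompactSpace B.carrier := by
    haveI := Motives.ComplexPoints.compactSpace_of_isSmoothProjective hX
    exact B.isAnalytification.homeomorph.symm.compactSpace
  -- the induced comparison: `B^*(ι^* c_ℙ) = e''[θ_X ⊗ 1]`
  have hd : HodgeModel.inducedIso A B hmn B.carrier 2 wX =
      B.pullback 2 (singularCohomology.map ℂ ℂ (Motives.AlgPoints.mapContinuous (L := ℂ) ι) 2 cP) := by
    rw [← hwPX, HodgeModel.inducedIso_apply,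
      ← LinearMap.comp_apply (g := complexDeRhamCohomology.map B.model hfan 2),
      ← complexDeRhamCohomology.map_comp hfan (contMDiff_cylFst A B hmn B.carrier),
      A.deRham_isNatural (Cyl A B hmn B.carrier) A.carrier _
        (hfan.comp (contMDiff_cylFst A B hmn B.carrier)) 2 wP,
      ← hcP, ← HodgeModel.map_anMap_pullback]
    change ((singularCohomology.map ℂ ℂ _ 2 ≫ singularCohomology.map ℂ ℂ _ 2).hom _) = _
    rw [← singularCohomology.map_comp]
    rfl
  -- rigidity: `e ⊗ ℂ = r • e''` on `H²_dR(X^an; ℂ)`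
  obtain ⟨r, hr⟩ := NaturalDeRhamComparisonRigidity_holds B.model B.model
    (HodgeModel.inducedFamily A B hmn) (HodgeModel.isNatural_inducedFamily A B hmn)
    e.complexify (DeRhamIsoFamily.complexify_isNatural he) B.carrier B.carrier (Homeomorph.refl _)
    contMDiff_id contMDiff_id 2
  have hrX : e.complexify B.carrier 2 wX = r • HodgeModel.inducedIso A B hmn B.carrier 2 wX := by
    have h := hr wX
    have hid : (⟨Homeomorph.refl B.carrier, (Homeomorph.refl B.carrier).continuous⟩ :
        C(B.carrier, B.carrier)) = ContinuousMap.id B.carrier := rfl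
    rw [hid, singularCohomology.map_id] at h
    change e.complexify B.carrier 2 wX =
      r • HodgeModel.inducedIso A B hmn B.carrier 2 (complexDeRhamCohomology.map B.model contMDiff_id 2 wX) at h
    rwa [complexDeRhamCohomology.map_id, LinearMap.id_apply] at h
  -- hence `H = r • ι^* c_ℙ`
  have hH' : H = r • singularCohomology.map ℂ ℂ (Motives.AlgPoints.mapContinuous (L := ℂ) ι) 2 cP := by
    apply B.pullback_injective 2
    rw [hH, _root_.map_smul, ← hd, ← hrX, complexify_apply, hwX, complexifyFun_ofReal]
  -- `H²(ℙᴺ(ℂ); ℂ)` is spanned by one rational class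
  rcases Nat.eq_zero_or_pos N with hN | hN
  · subst hN
    haveI := Motives.ComplexPoints.subsingleton_singularCohomology_of_lt hP ℂ (k := 2) (by omega)
    refine ⟨0, 0, IsRationalClass.zero, ?_⟩
    rw [hH', Subsingleton.elim cP 0]
    simp
  have h1 : Module.finrank ℂ (complexBetti (projectiveSpace N ℂ) 2) = 1 :=
    finrank_complexBetti_projectiveSpace_two_mul_eq_one N (p := 1) hN
  obtain ⟨rP, hrP, -, hspan⟩ := exists_mem_ne_zero_of_span_eq_top
    (span_isRationalClass_eq_top_of_isSmoothProjective_holds N (projectiveSpace N ℂ) hP 2) h1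
  obtain ⟨lam, hlam⟩ := hspan cP
  refine ⟨rP, r * lam, hrP, ?_⟩
  rw [hH', ← hlam, _root_.map_smul, smul_smul]

/-- **Hodge–Riemann for the polarization form of a Kähler–rational datum, in the shape consumed by
`bku_finite_monodromyOrbit_of_isHodgeGenericIn_of_inputs`**: for any class `κ` EQUAL to the rational
Kähler class `η ⊗ 1` of the datum, `κ` has the hard Lefschetz property, and for the normalised trace
`τ_ℂ` the form `polarizationForm κ n … τ_ℂ (2p)` (which is the complexified polarisation `Q_ℂ` of the
datum) is RATIONAL on rational classes (`algebraMap_form`) and POSITIVE on non-zero rational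
`(p,p)`-classes (`cform_conj_pos`: `i^{p-p} Q_ℂ(x, x̄) > 0`, with `x̄ = x` for `x` rational).
[cite: VoisinHodgeI2002, Thm. 6.25, Thm. 6.32 and §7.1.2] -/
theorem KaehlerRationalDatum.exists_polarizationForm_rational_pos (D : KaehlerRationalDatum n X)
    (hX : Motives.IsSmoothProjective n X) (p : ℕ) {κ : complexBetti X 2} (hκ : κ = D.Hη) :
    ∃ (hL : HasHardLefschetzProperty κ n) (τ : complexBetti X (2 * n) →ₗ[ℂ] ℂ),
      (∀ x y : complexBetti X (2 * p), IsRationalClass x → IsRationalClass y → ∃ q : ℚ,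
          polarizationForm κ n hL
            (fun _ hm ↦ ComplexPoints.subsingleton_singularCohomology_of_lt hX ℂ hm) τ (2 * p) x y = q) ∧
      (∀ x : complexBetti X (2 * p), IsRationalClass x → IsOfHodgeType n X (2 * p) p p x → x ≠ 0 →
          ∃ r : ℚ, 0 < r ∧ polarizationForm κ n hL
            (fun _ hm ↦ ComplexPoints.subsingleton_singularCohomology_of_lt hX ℂ hm) τ (2 * p) x x = r) := by
  subst hκ
  have hrat : ∀ x y : complexBetti X (2 * p), IsRationalClass x → IsRationalClass y → ∃ q : ℚ,
      D.cform hX (2 * p) x y = q := by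
    intro x y hx hy
    obtain ⟨v, rfl⟩ := (isRationalClass_iff_mem_range_ofRatClass _).1 hx
    obtain ⟨w, rfl⟩ := (isRationalClass_iff_mem_range_ofRatClass _).1 hy
    exact ⟨D.form hX (2 * p) v w, by rw [← D.algebraMap_form hX, eq_ratCast]⟩
  refine ⟨D.hLℂ hX, D.cTrace hX, hrat, fun x hx hxT hx0 ↦ ?_⟩
  change ∃ r : ℚ, 0 < r ∧ D.cform hX (2 * p) x x = r
  obtain ⟨q, hq⟩ := hrat x x hx hx
  have hpq : (p, p) ∈ Finset.HasAntidiagonal.antidiagonal (2 * p) :=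
    Finset.HasAntidiagonal.mem_antidiagonal.2 (by omega)
  have hx' : x ∈ D.B.typePiece (2 * p) ⟨(p, p), hpq⟩ :=
    D.B.mem_typePiece_of_isOfHodgeType hodgePQ_independent_of_hodgeModel_holds hX hpq hxT
  obtain ⟨r, hr, heq⟩ := D.cform_conj_pos hX D.B hpq hx' hx0
  rw [hx.conjClass_eq, sub_self, zpow_zero, one_mul, hq] at heq
  refine ⟨q, ?_, hq⟩
  have hqr : (q : ℝ) = r := Complex.ofReal_injective (by rw [Complex.ofReal_ratCast]; exact heq)
  exact_mod_cast (hqr ▸ hr : (0 : ℝ) < q)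

end Datum

/-! ### The input `hHR` for smooth projective families with quasi-projective total space -/

section Family

variable {𝒳 S : SchemeOver ℂ}

/-- **The relative hyperplane class polarises every fibre (complex families).** For a smooth
projective family `f : 𝒳 ⟶ S` over a separated `S` with `𝒳` quasi-projective, and every complex
point `s`, there is a GLOBAL class `K ∈ H²(𝒳(ℂ); ℂ)` — the pull-back of a class of `H²(ℙᴺ(ℂ); ℂ)`
along `𝒳 ↪ P ↪ ℙᴺ` — whose restriction `K|_{X_s}` is the rational Kähler class of a Kähler–rational
datum of `X_s` (`exists_kaehlerRationalDatum_eq_map` for the closed immersion `X_s ↪ 𝒳 → ℙᴺ`), hence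
has the hard Lefschetz property and a polarization form rational on rational classes and positive
on non-zero rational `(p,p)`-classes. [cite: VoisinHodgeI2002, Thm. 6.25, Thm. 6.32 and §7.1.2] -/
theorem exists_global_polarizationForm_rational_pos (f : 𝒳 ⟶ S) (n p : ℕ)
    (hf : IsSmoothProjectiveFamily f n) (h𝒳 : IsQuasiProjectiveOver 𝒳) [IsSeparated S.hom]
    (s : ComplexPoints S) :
    ∃ (K : complexBetti 𝒳 2)
      (hL : HasHardLefschetzProperty (complexBetti.map (fiberι f s) 2 K) n)
      (τ : complexBetti (fiberOver f s) (2 * n) →ₗ[ℂ] ℂ),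
      (∀ x y : complexBetti (fiberOver f s) (2 * p), IsRationalClass x → IsRationalClass y → ∃ q : ℚ,
          polarizationForm (complexBetti.map (fiberι f s) 2 K) n hL
            (fun _ hm ↦ ComplexPoints.subsingleton_singularCohomology_of_lt
              (hf.isSmoothProjective s) ℂ hm) τ (2 * p) x y = q) ∧
      (∀ x : complexBetti (fiberOver f s) (2 * p), IsRationalClass x →
          IsOfHodgeType n (fiberOver f s) (2 * p) p p x → x ≠ 0 → ∃ r : ℚ, 0 < r ∧
            polarizationForm (complexBetti.map (fiberι f s) 2 K) n hL
              (fun _ hm ↦ ComplexPoints.subsingleton_singularCohomology_of_lt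
                (hf.isSmoothProjective s) ℂ hm) τ (2 * p) x x = r) := by
  obtain ⟨N, ε, hε⟩ := IsQuasiProjectiveOver.exists_isPreimmersion h𝒳
  haveI := hε
  haveI := hf.isProper
  haveI : IsClosedImmersion (fiberι f s ≫ ε).left :=
    isClosedImmersion_fiberι_comp_left_of_isPreimmersion f ε s
  obtain ⟨D, c, hc⟩ := exists_kaehlerRationalDatum_eq_map (hf.isSmoothProjective s) (fiberι f s ≫ ε)
  refine ⟨complexBetti.map ε 2 c, D.exists_polarizationForm_rational_pos (hf.isSmoothProjective s) p ?_⟩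
  rw [hc, complexBetti.map_comp]
  rfl

/-- A private copy of `IsQuasiProjectiveOver.baseChangeHom` (file `HodgeGenericQbarDescentProofs`,
not imported): quasi-projectivity is stable under extension of the base field.
[cite: Liu2002, Prop. 3.1.23 and Rem. 3.1.20] -/
private theorem isQuasiProjectiveOver_baseChangeHom'' {k L : Type} [Field k] [Field L] (σ : k →+* L)
    {X : Motives.SchemeOver k} (h : IsQuasiProjectiveOver X) :
    IsQuasiProjectiveOver ((Motives.baseChangeHom σ).obj X) := by
  obtain ⟨P, j, hP, hj⟩ := h
  letI := σ.toAlgebra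
  refine ⟨(Motives.baseChangeHom σ).obj P, (Motives.baseChangeHom σ).map j, hP.baseChange_obj L, ?_⟩
  exact MorphismProperty.IsStableUnderBaseChange.of_isPullback
    (Motives.isPullback_baseChange_map_left L j).flip hj

/-- **The input `hHR` of `bku_finite_monodromyOrbit_of_isHodgeGenericIn_of_inputs`, proved**: for the
base change along `σ : ℚ̄ → ℂ` of a smooth projective family of quasi-projective `ℚ̄`-varieties and
every complex point `s` of the base, a global class `K ∈ H²(𝒳(ℂ); ℂ)` whose restriction to `X_s` has
the hard Lefschetz property and a polarization form rational on rational classes and positive on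
non-zero rational `(p,p)`-classes (`exists_global_polarizationForm_rational_pos`; the base is
separated, being quasi-projective). [cite: VoisinHodgeI2002, Thm. 6.25, Thm. 6.32 and §7.1.2] -/
theorem hodgeRiemann_polarizationForm_qbarFamily (σ : AlgebraicClosure ℚ →+* ℂ)
    ⦃𝒳₀ S₀ : SchemeOver (AlgebraicClosure ℚ)⦄ (f₀ : 𝒳₀ ⟶ S₀) (n p : ℕ)
    (hf : IsSmoothProjectiveFamily ((baseChangeHom σ).map f₀) n)
    (h𝒳₀ : IsQuasiProjectiveOver 𝒳₀) (hS₀ : IsQuasiProjectiveOver S₀) (_ : IrreducibleSpace S₀.left)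
    (_ : AlgebraicGeometry.Smooth S₀.hom) (s : ComplexPoints ((baseChangeHom σ).obj S₀)) :
    ∃ (K : complexBetti ((baseChangeHom σ).obj 𝒳₀) 2)
      (hL : HasHardLefschetzProperty
        (complexBetti.map (fiberι ((baseChangeHom σ).map f₀) s) 2 K) n)
      (τ : complexBetti (fiberOver ((baseChangeHom σ).map f₀) s) (2 * n) →ₗ[ℂ] ℂ),
      (∀ x y : complexBetti (fiberOver ((baseChangeHom σ).map f₀) s) (2 * p),
          IsRationalClass x → IsRationalClass y → ∃ q : ℚ,
            polarizationForm (complexBetti.map (fiberι ((baseChangeHom σ).map f₀) s) 2 K) n hL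
              (fun _ hm ↦ ComplexPoints.subsingleton_singularCohomology_of_lt
                (hf.isSmoothProjective s) ℂ hm) τ (2 * p) x y = q) ∧
      (∀ x : complexBetti (fiberOver ((baseChangeHom σ).map f₀) s) (2 * p),
          IsRationalClass x → IsOfHodgeType n (fiberOver ((baseChangeHom σ).map f₀) s) (2 * p) p p x →
            x ≠ 0 → ∃ r : ℚ, 0 < r ∧
              polarizationForm (complexBetti.map (fiberι ((baseChangeHom σ).map f₀) s) 2 K) n hL
                (fun _ hm ↦ ComplexPoints.subsingleton_singularCohomology_of_lt
                  (hf.isSmoothProjective s) ℂ hm) τ (2 * p) x x = r) := by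
  haveI : IsSeparated ((baseChangeHom σ).obj S₀).hom :=
    IsQuasiProjectiveOver.isSeparated (isQuasiProjectiveOver_baseChangeHom'' σ hS₀)
  exact exists_global_polarizationForm_rational_pos ((baseChangeHom σ).map f₀) n p hf
    (isQuasiProjectiveOver_baseChangeHom'' σ h𝒳₀) s

end Family

/-! ### The named fact from type stability alone -/

/-- **`bku_finite_monodromyOrbit_of_isHodgeGenericIn` from the single input `hType`** (type stability
of the monodromy translates of a rational `(p,p)` class at a point of maximal Mumford–Tate rank;
Deligne 1972, Prop. 7.5; André 1992, Thm. 1; Baldi–Klingler–Ullmo §3.2): the Hodge–Riemann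
input `hHR` of `bku_finite_monodromyOrbit_of_isHodgeGenericIn_of_inputs` is
`hodgeRiemann_polarizationForm_qbarFamily`. [cite: BaldiKlinglerUllmo2024, §3.2]
[cite: Deligne1972WeilK3, Prop. 7.5] [cite: VoisinHodgeI2002, Thm. 6.32 and §7.1.2] -/
theorem bku_finite_monodromyOrbit_of_isHodgeGenericIn_of_hType
    (hType : ∀ [HodgeTensorFacts.{0, 0}] (σ : AlgebraicClosure ℚ →+* ℂ)
      ⦃𝒳₀ S₀ : SchemeOver (AlgebraicClosure ℚ)⦄ (f₀ : 𝒳₀ ⟶ S₀) (n p : ℕ)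
      (hf : IsSmoothProjectiveFamily ((baseChangeHom σ).map f₀) n)
      (_ : IsQuasiProjectiveOver 𝒳₀) (hS₀ : IsQuasiProjectiveOver S₀) [IrreducibleSpace S₀.left]
      [AlgebraicGeometry.Smooth S₀.hom]
      (A : ∀ t : ComplexPoints ((baseChangeHom σ).obj S₀),
          HodgeModel n (fiberOver ((baseChangeHom σ).map f₀) t))
      (hA : ∀ t, (A t).IsHodgeSymmetric)
      [∀ t, Module.Finite ℚ
        (singularCohomology ℚ ℚ (ComplexPoints (fiberOver ((baseChangeHom σ).map f₀) t)) (2 * p))]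
      (s : ComplexPoints ((baseChangeHom σ).obj S₀)),
      (∀ t, ((A t).hodgeStructure (hf.isSmoothProjective t) (hA t) (2 * p)).mtRank ≤
          ((A s).hodgeStructure (hf.isSmoothProjective s) (hA s) (2 * p)).mtRank) →
      ∀ (α : complexBetti (fiberOver ((baseChangeHom σ).map f₀) s) (2 * p)),
        IsRationalClass α → IsOfHodgeType n (fiberOver ((baseChangeHom σ).map f₀) s) (2 * p) p p α →
        ∀ γ : Path.Homotopic.Quotient
            (⟨s, Set.mem_univ s⟩ : (Set.univ : Set (ComplexPoints ((baseChangeHom σ).obj S₀))))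
            ⟨s, Set.mem_univ s⟩,
          IsOfHodgeType n (fiberOver ((baseChangeHom σ).map f₀) s) (2 * p) p p
            (transportFun ((baseChangeHom σ).map f₀) (2 * p)
              (isCohomologicallyLocallyTrivialOn_univ_baseChangeHom σ f₀ hf hS₀) γ α :)) :
    bku_finite_monodromyOrbit_of_isHodgeGenericIn :=
  bku_finite_monodromyOrbit_of_isHodgeGenericIn_of_inputs
    (fun σ _ _ f₀ n p hf h𝒳₀ hS₀ hirr hsm s ↦
      hodgeRiemann_polarizationForm_qbarFamily σ f₀ n p hf h𝒳₀ hS₀ hirr hsm s)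
    hType

end HodgeTheory

end Literature.AlgebraicGeometry.HodgeTheory

end
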